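import Literature.NumberTheory.EllipticCurves.HeckeEigenvalueSupNormStrictProofs
import Literature.NumberTheory.EllipticCurves.NewformsHeckeProofs
import Literature.NumberTheory.EllipticCurves.GreenbergSelmerNewformDatum
import Literature.FieldTheory.AlgClosed.PadicAlgClEquivComplexCompatible
import HarnessLib

/-!
# No root of `X² − a_p X + p^{k−1}` is a root of unity, for a newform on `Γ₀(M)` and `p ∤ M` — in `ℂ` and in `ℚ̄_p` (proofs only)

Topic `NumberTheory/EllipticCurves` (namespace `Literature.NumberTheory.EllipticCurves.ModularForms`). THEOREMS ONLY (no definition,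
no named fact; D-0026). An elementary substitute for Deligne's theorem in "the unit root `α_p` of an ordinary newform has infinite
order": if a root `z` of `X² − μX + p^{k−1}` (`μ` an eigenvalue of `T_p` on `S_k(Γ₀(M))`, `p ∤ M`, `k ≥ 2`) were a root of unity then,
`μ = z + p^{k−1} z̄` being REAL (`conj_eq_of_hasEigenvalue_heckeT`, self-adjointness of `T_p`), `z = ±1` and `|μ| = 1 + p^{k−1}`, against
the STRICT trivial bound `|μ|² < (p+1)² p^{k−2}` (`norm_sq_lt_of_heckeT_eq_smul`, tree) since `(1 + p^n)² − (p+1)² p^{n−1} =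
(p^{n+1} − 1)(p^{n−1} − 1) ≥ 0`. The weight-two case is the tree's `false_of_rootOfUnity_root_weight_two`.

* `false_of_rootOfUnity_root` — complex form, any weight `k ≥ 2`;
* `pow_ne_one_of_root_heckePolynomial_padic` — for `ι : K_g → ℚ̄_p` and `α ∈ ℚ̄_p` with `α² − ι(a_p)α + p^{k−1} = 0`: `αⁿ ≠ 1` for
  all `n ≥ 1` (through a compatible `ι' : ℚ̄_p ≃ ℂ`, `exists_padicAlgCl_ringEquiv_complex_apply_eq_of_finiteDimensional`).

Use: cell `bsd-stepL`, crux 25505, stub (FIX): the hypothesis `htors` of `PadicUnitPowers.tendsto_natCast_padicInt_zero_of_tendsto_pow_of_norm_pow_sub_one_lt`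
for `α = α_p`, the unit root (exponent separation of the unramified quotient character at Frobenius).

References: [DiamondShurman2005] Prop. 5.2.1, Thm. 5.5.3; [Deligne1974] Thm. 8.2 (not used).
-/

noncomputable section

open scoped MatrixGroups ModularForm ComplexConjugate
open CongruenceSubgroup UpperHalfPlane
open Literature.FieldTheory.AlgClosed

namespace Literature.NumberTheory.EllipticCurves.ModularForms

variable {N : ℕ} [NeZero N] {k : ℤ} {p : ℕ}

/-- **No root of `X² − μX + p^{k−1}` is a root of unity** for an eigenvalue `μ` of `T_p` (`p ∤ N` prime) on `S_k(Γ₀(N))`, `k ≥ 2`.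
[cite: DiamondShurman2005, Thm. 5.5.3 and Prop. 5.2.1] -/
theorem false_of_rootOfUnity_root [NeZero p] (hp : p.Prime) (hpN : ¬ p ∣ N) (hk : 2 ≤ k) {f : CuspForm (Gamma0 N) k}
    (hf : f ≠ 0) {μ : ℂ} (hμ : heckeT (Gamma0 N) k p f = μ • f) {z : ℂ} {m : ℕ} (hm : 0 < m)
    (hzm : z ^ m = 1) (hroot : z ^ 2 - μ * z + (p : ℂ) ^ (k - 1) = 0) : False := by
  -- `p^{k-1} = p^{n+1}` with `n = k - 2 ≥ 0`
  obtain ⟨n, hn⟩ : ∃ n : ℕ, ((n : ℕ) : ℤ) = k - 2 := ⟨(k - 2).toNat, Int.toNat_of_nonneg (by omega)⟩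
  have hq : (p : ℂ) ^ (k - 1) = ((p ^ (n + 1) : ℕ) : ℂ) := by
    rw [show k - 1 = ((n + 1 : ℕ) : ℤ) by push_cast; omega, zpow_natCast]; push_cast; ring
  rw [hq] at hroot
  set q : ℕ := p ^ (n + 1) with hqdef
  have hz1 : ‖z‖ = 1 := by
    have h : ‖z‖ ^ m = 1 := by rw [← norm_pow, hzm, norm_one]
    exact (pow_eq_one_iff_of_nonneg (norm_nonneg z) hm.ne').mp h
  have hz0 : z ≠ 0 := fun h ↦ by simp [h] at hz1
  have hzz : z * conj z = 1 := by
    rw [Complex.mul_conj, Complex.normSq_eq_norm_sq, hz1]; norm_num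
  -- `μ = z + q conj z`
  have hμz : μ = z + (q : ℂ) * conj z := by
    have h1 : μ * z = z ^ 2 + (q : ℂ) := by linear_combination -hroot
    have h2 : μ = (z ^ 2 + (q : ℂ)) * conj z := by
      rw [← h1, mul_assoc, hzz, mul_one]
    rw [h2]; linear_combination z * hzz
  -- `μ` real ⟹ `z` real (`q ≠ 1`)
  have hreal : conj μ = μ :=
    conj_eq_of_hasEigenvalue_heckeT hp hpN (Module.End.hasEigenvalue_of_hasEigenvector ⟨Module.End.mem_eigenspace_iff.mpr hμ, hf⟩)
  have hq1 : 1 < q := by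
    rw [hqdef]; exact Nat.one_lt_pow (Nat.succ_ne_zero n) hp.one_lt
  have hzreal : conj z = z := by
    have h := hreal
    rw [hμz, map_add, map_mul, Complex.conj_conj, map_natCast] at h
    have h' : ((q : ℂ) - 1) * (z - conj z) = 0 := by linear_combination h
    rcases mul_eq_zero.mp h' with h'' | h''
    · exfalso
      have : (q : ℂ) = 1 := by linear_combination h''
      exact hq1.ne' (by exact_mod_cast this)
    · exact (sub_eq_zero.mp h'').symm
  -- so `z = ±1`, `‖μ‖ = q + 1`
  have hμ' : μ = z * ((q : ℂ) + 1) := by rw [hμz, hzreal]; ring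
  have hnorm : ‖μ‖ = (q : ℝ) + 1 := by
    rw [hμ', norm_mul, hz1, one_mul]
    exact_mod_cast Complex.norm_natCast (q + 1)
  -- strict bound `‖μ‖² < (p+1)² p^{k-2} = (p+1)² pⁿ`
  have hlt := norm_sq_lt_of_heckeT_eq_smul hp hpN hf hμ
  rw [hnorm, ← hn, zpow_natCast] at hlt
  -- but `(q+1)² − (p+1)² pⁿ = (p^{n+2} − 1)(pⁿ − 1) ≥ 0`
  have hp1 : (1 : ℝ) ≤ p := by exact_mod_cast hp.one_lt.le
  have hkey : ((p : ℝ) + 1) ^ 2 * (p : ℝ) ^ n ≤ ((q : ℝ) + 1) ^ 2 := by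
    have hq' : (q : ℝ) = (p : ℝ) ^ (n + 1) := by rw [hqdef]; push_cast; ring
    rw [hq']
    nlinarith [one_le_pow₀ (M₀ := ℝ) hp1 (n := n), one_le_pow₀ (M₀ := ℝ) hp1 (n := n + 2),
      mul_nonneg (sub_nonneg.mpr (one_le_pow₀ (M₀ := ℝ) hp1 (n := n + 2)))
        (sub_nonneg.mpr (one_le_pow₀ (M₀ := ℝ) hp1 (n := n))),
      pow_succ (p : ℝ) n, pow_succ (p : ℝ) (n + 1)]
  exact absurd hlt (not_lt.mpr hkey)

variable {M : ℕ} [NeZero M]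

/-- **The roots of `X² − ι(a_p)X + p^{k−1}` in `ℚ̄_p` have infinite order** (`g ∈ S_k(Γ₀(M))` a newform, `K_g` a number field,
`k ≥ 2`, `p ∤ M` prime, `ι : K_g → ℚ̄_p`): transport to `ℂ` along `ι' : ℚ̄_p ≃ ℂ` with `ι' ∘ ι = (K_g ⊆ ℂ)` and apply
`false_of_rootOfUnity_root` to the eigenvalue `a_p(g)` of `T_p` (`IsNewform0.heckeT_eq_coeff_smul`). In particular the unit root
`α_p` of an ordinary newform is not a root of unity. [cite: DiamondShurman2005, Thm. 5.5.3 and Prop. 5.2.1] -/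
theorem pow_ne_one_of_root_heckePolynomial_padic {g : CuspForm (Gamma0 M) k} (hg : IsNewform0 g) (hk : 2 ≤ k)
    {p : ℕ} [Fact p.Prime] (hpM : ¬ p ∣ M) [FiniteDimensional ℚ (coeffField g)] (ι : coeffField g →+* PadicAlgCl p)
    {α : PadicAlgCl p}
    (hα : α ^ 2 - ι ⟨(qExpansion 1 ⇑g).coeff p, coeff_mem_coeffField g p⟩ * α + (p : PadicAlgCl p) ^ (k - 1) = 0)
    {n : ℕ} (hn : 0 < n) : α ^ n ≠ 1 := by
  have hp : p.Prime := Fact.out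
  haveI : NeZero p := ⟨hp.ne_zero⟩
  intro hαn
  obtain ⟨ι', hι'⟩ := exists_padicAlgCl_ringEquiv_complex_apply_eq_of_finiteDimensional ι (algebraMap (coeffField g) ℂ)
  have hg0 : g ≠ 0 := by
    intro h0
    have h1 : IsNormalized g := hg.2.2
    rw [IsNormalized, h0] at h1
    simp [UpperHalfPlane.qExpansion_zero] at h1
  have hμ : heckeT (Gamma0 M) k p g = (qExpansion 1 ⇑g).coeff p • g := IsNewform0.heckeT_eq_coeff_smul hg hp
  -- transport the relation and the torsion to `ℂ`
  have hroot : (ι' α) ^ 2 - (qExpansion 1 ⇑g).coeff p * ι' α + (p : ℂ) ^ (k - 1) = 0 := by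
    have h := congrArg ι' hα
    rw [map_zero, map_add, map_sub, map_pow, map_mul, hι', map_zpow₀, map_natCast] at h
    exact h
  have hzm : (ι' α) ^ n = 1 := by rw [← map_pow, hαn, map_one]
  exact false_of_rootOfUnity_root hp hpM hk hg0 hμ hn hzm hroot

end Literature.NumberTheory.EllipticCurves.ModularForms

end
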